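import Summits.QuantumFields.BalabanUV.T4Continuum.Spine.NE1p.DressedStabilityStrictOfSuppliedComposition
import Summits.QuantumFields.BalabanUV.T4Continuum.Spine.NE1p.DressedCompositionWitness

/-!
# T⁴ programme, spine estimate NE1′ (node O3b/H2) — THE VALUE MAP ACTS: row S3u's L-V SOCKET FIRES WITH A NON-IDENTITY PUSH on
# row W18's decided datum `towerC` at the integer `L = 2` (UNIT scale-`k` fresh pairs; the contraction `θ = L⁻² = ¼` PERFORMED by the
# value map, not posited on the pairs)

Cell `pub-balaban`, sub-cell `t4`, BINDER-OWNERS row NE1′, formalisation crew `b2b-balaban-t4-ne1p-formalise-*`, seat `leaf-09` (gen 5;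
author of row S3u).  ADDITIVE — imports row S3u `Spine/NE1p/DressedStabilityStrictOfSuppliedComposition` (p218916: the L-V socket
`hsl_of_birthSlice` ∕ `hdefw_of_push` ∕ `hrate_of_push` ∕ `hlin_of_push`) and row W18 `Spine/NE1p/DressedCompositionWitness` (p218795:
the decided datum `towerC` — bookings `BC K`, trajectory `TC K`, carried functions `FnC`, live sets `SC`, and its discharges `hsl_C` (AT
BIRTH), `hinv_C`, `hbirth_C`, `hreg_C`, `hS_C`, `hcount_C`, `positionalCount_C` BY NAME) ONLY; THEOREMS ONLY; modifies nothing.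

WHY.  W18 fires the (γ) face of record with «an IDENTITY value map: the function never moves» and the felt-size decay POSITED on the
fresh pairs (`defC k′ k = ¼^(k−k′)`, its docstring: «(VAL-θ) untouched»).  Row S3u's socket displays (VAL-θ) as TWO binders on a value
map `V b k′ k : 𝒳 → 𝒰` PUSHING the scale-`k` pairs into the birth frame — containment `hVK`, felt-size contraction `hVrel` — plus the
booking convention `hneX`∕`hsupX` over the scale-`k` pairs; NO landed file applies them (`hlin_of_push` ∕ `composedLeaf_of_valueMap` ∕
`dressedStabilityStrict_of_suppliedComposition`: 0 users).  THIS FILE inhabits them NON-VACUOUSLY on W18's datum UNCHANGED: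
* the scale-`k` configuration space is the complex line with its affine chart, regular set `closedBall 0 1`, relation `=`, and UNIT
  fresh defects `δX k = 1` at EVERY scale (no decay posited on the pairs);
* the VALUE MAP of generation `(b, k′)` to scale `k` is the FRAME RESCALING `V b k′ k X = θ^(k−k′)·X`, `θ = ¼ = (2²)⁻¹` — a NON-identity
  linear push; `hVK` is `‖θ^n X‖ ≤ ‖X‖ ≤ 1` and `hVrel` is LINEARITY: a unit pair `(X₀, X₀ + d)`, `0 < ‖d‖ ≤ δ`, is pushed to
  `(θ^n X₀, θ^n X₀ + θ^n d)` of defect `θ^n·δ` — the contraction is DONE BY `V`;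
* the composed function `G b k′ ∘ V b k′ k = (gC K b · θ^(k−k′)) · X` MOVES with `k` (its felt size at scale `k` is `gC·θ^(k−k′)`), and
  W18's booked size `sizeC K b k = gC K b · ¼^(k−b)` IS its response to the UNIT pair `(0, 1)` (`hsupX` attained, `hneX` by that pair);
* then N0e's `dressedStabilityStrict_of_composition` BY NAME, ONE application, with `hsl`∕`hdefw`∕`hrate`∕`hlin` := S3u's four socket
  lemmas on these data and W18's `hbirth_C` ∕ `hreg_C` ∕ `hS_C` ∕ `hcount_C` BY NAME, at W18's constants (`L = 2, a = 1, c_δ = r = w = 1,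
  c̄ = 0, N₀ = A₀ = 1, m = ½, s̄⁰ = 0, ρ′ = ½`; `θ = ψ = ¼`): `valueMap_fires` = (the push CONTRACTS every configuration by exactly
  `θ^(k−k′)`) ∧ `DressedStabilityStrict towerC ((2:ℝ)^4)` — stated CONJOINED because the bare ROOT-C statement is W18's
  `dressedStabilityStrict_towerC` (`dedup.landed`); the bare ROOT-C ∕ headline ∕ ROOT-B on these data are the `example`s right after
  (k4: `Λ = 2⁴` = the datum's count rate `hcount_C` ∕ `positionalCount_C`).

HONEST FRAMING (c4; swarm row W20 of `t4/formal/NE1p/LEAVES.md`, BOOKED typer R-T78 (i), conditions (a)–(g)).  «Row S3u's value-map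
socket fires with a non-identity push on one decided deterministic datum at `L = 2`: the felt-size contraction is performed by a linear
rescaling map on unit pairs; a toy frame change, NOT Bałaban's minimiser ∕ background map; (VAL-θ) for Bałaban's minimiser ∕ background
maps UNTOUCHED; under the owner's wall v1.5-proposed (VAL-θ) is booked inside L-P's `s_V` — this toy says nothing about it; nothing of
Bałaban's; NE1′ NOT proved».  [decided toy] ∕ [folklore]; 0 `def … : Prop` (the one
`def` is the toy value map, DATA); 0 sorry; 0 citations.  NE1′ NOT printed, NOT proved; spine PROVED 0∕9.  Rung (B)+1 on ONE finite
four-torus — NOT infinite volume, NOT a mass gap, NOT OS on ℝ⁴, NOT Clay.  HONEST DEPENDENCY: continuum YM on T⁴ ⇐ BetaPertH ∧ nine spine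
estimates (0/9 proved); BetaPertH ⇐ (D1) ∧ (D4) ∧ CAP+tail; G-an2-4 gates asym, D1 and NE2/3/4.
-/

noncomputable section

namespace Summit.QuantumFields.BalabanUV.T4Continuum.NE1p.DressedValueMapWitness

open Set Metric Finset
open scoped BigOperators
open Literature.MathematicalPhysics.QuantumFieldTheory.Balaban1983to89
open Literature.MathematicalPhysics.QuantumFieldTheory.Balaban1983to89.T4TermFormat
open Literature.MathematicalPhysics.QuantumFieldTheory.Balaban1983to89.T4TrajectoryComparison
open Literature.MathematicalPhysics.QuantumFieldTheory.Balaban1983to89.T4BirthChartTransport (GaugeInvariant BirthSlice RelGauge)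
open Summit.QuantumFields.BalabanUV.T4Continuum.T4TrajectoryDensityDressed
open Summit.QuantumFields.BalabanUV.T4Continuum.NE1p.DressedRoot
open Summit.QuantumFields.BalabanUV.T4Continuum.NE1p.DressedUniformConstants
open Summit.QuantumFields.BalabanUV.T4Continuum.NE1p.DressedRootComposition
open Summit.QuantumFields.BalabanUV.T4Continuum.NE1p.DressedStabilityStrictOfSuppliedComposition
open Summit.QuantumFields.BalabanUV.T4Continuum.NE1p.DressedCompositionWitness

/-! ## §1 The value map: the frame rescaling `X ↦ θ^(k−k′)·X`, `θ = ¼` [decided toy] -/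

/-- THE VALUE MAP of generation `k′` to scale `k` [decided toy]: the frame rescaling by `θ^(k−k′)`, `θ = ¼ = (2²)⁻¹` — a NON-identity
linear push of the scale-`k` configuration into the birth frame.  Toy DATA; NOT Bałaban's minimiser ∕ background map. [folklore] -/
def vmap (k' k : ℕ) (X : ℂ) : ℂ := (((1 / 4 : ℝ) ^ (k - k') : ℝ) : ℂ) * X

/-- [folklore] The push contracts norms by EXACTLY `θ^(k−k′)`. -/
theorem norm_vmap (k' k : ℕ) (X : ℂ) : ‖vmap k' k X‖ = (1 / 4 : ℝ) ^ (k - k') * ‖X‖ := by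
  unfold vmap
  rw [norm_mul, Complex.norm_real, Real.norm_of_nonneg (by positivity)]

/-- [folklore] The push is LINEAR along the affine chart: `V (X + t·d) = V X + t·(V d)`. -/
theorem vmap_affine (k' k : ℕ) (X d t : ℂ) : vmap k' k (X + t * d) = vmap k' k X + t * vmap k' k d := by
  unfold vmap; ring

/-- [folklore] `θ^n ≤ 1`. -/
theorem theta_pow_le_one (n : ℕ) : (1 / 4 : ℝ) ^ n ≤ 1 := pow_le_one₀ (by norm_num) (by norm_num)

/-! ## §2 S3u's socket binders on W18's datum: containment, felt-size contraction BY THE MAP, the booking convention on UNIT pairs -/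

/-- **`hVK` — (VAL-θ)-lite CONTAINMENT, GENUINE** [decided toy]: the push of a scale-`k` regular configuration (`‖X‖ ≤ 1`) lands in the
birth regular set `closedBall 0 1` (indeed in the smaller ball of radius `θ^(k−k′)`). [folklore] -/
theorem hVK_C (K : ℕ) : ∀ (b : (BC K).Birth) (k' k : ℕ), (BC K).birthScale b ≤ k' → k' ≤ k → k ≤ (BC K).K →
    ∀ X₀ ∈ closedBall (0 : ℂ) 1, vmap k' k X₀ ∈ closedBall (0 : ℂ) 1 := by
  intro b k' k _ _ _ X₀ hX₀
  rw [mem_closedBall_zero_iff] at hX₀ ⊢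
  rw [norm_vmap]
  calc (1 / 4 : ℝ) ^ (k - k') * ‖X₀‖ ≤ 1 * 1 :=
        mul_le_mul (theta_pow_le_one _) hX₀ (norm_nonneg _) zero_le_one
    _ = 1 := one_mul _

/-- **`hVrel` — (VAL-θ) FELT-SIZE CONTRACTION PERFORMED BY THE MAP** [decided toy]: a scale-`k` pair `(X₀, X₀ + 1·d)` with
`0 < ‖d‖ ≤ δ` is pushed to the pair `(V X₀, V X₀ + 1·(V d))` with `0 < ‖V d‖ = θ^(k−k′)·‖d‖ ≤ θ^(k−k′)·δ` — LINEARITY of the push;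
no decay is posited on the pair. [folklore] -/
theorem hVrel_C (K : ℕ) : ∀ (b : (BC K).Birth) (k' k : ℕ), (BC K).birthScale b ≤ k' → k' ≤ k → k ≤ (BC K).K →
    ∀ X₀ ∈ closedBall (0 : ℂ) 1, ∀ X₁ : ℂ, ∀ δ : ℝ,
      RelGauge (fun U U' : ℂ => U = U') (fun U d t => U + t * d) (fun d : ℂ => ‖d‖) X₀ X₁ δ →
      RelGauge (fun U U' : ℂ => U = U') (fun U d t => U + t * d) (fun d : ℂ => ‖d‖) (vmap k' k X₀) (vmap k' k X₁)
        ((1 / 4 : ℝ) ^ (k - k') * δ) := by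
  intro b k' k _ _ _ X₀ _ X₁ δ h
  obtain ⟨d, hd0, hdδ, hX₁⟩ := h
  refine ⟨vmap k' k d, ?_, ?_, ?_⟩
  · show 0 < ‖vmap k' k d‖
    rw [norm_vmap]; exact mul_pos (by positivity) hd0
  · show ‖vmap k' k d‖ ≤ (1 / 4 : ℝ) ^ (k - k') * δ
    rw [norm_vmap]; exact mul_le_mul_of_nonneg_left hdδ (by positivity)
  · show vmap k' k X₁ = vmap k' k X₀ + 1 * vmap k' k d
    rw [show X₁ = X₀ + 1 * d from hX₁, vmap_affine]

/-- **`hneX` — ADMISSIBLE UNIT PAIRS EXIST at every scale** [decided toy]: `(0, 0 + 1·1)`, defect `‖1‖ = 1 = δX k`. [folklore] -/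
theorem hneX_C (K : ℕ) : ∀ (b : (BC K).Birth) (k' k : ℕ), (BC K).birthScale b ≤ k' → k' ≤ k → k ≤ (BC K).K →
    RanBelow (budgetGate (TC K) (fun _ _ => (0 : ℝ)) (1 / 2) (SC K) (4 * 1 / 1) (fun _ : ℕ => ((2 : ℝ) ^ 2)⁻¹ * 1)) k →
    ∃ X₀ ∈ closedBall (0 : ℂ) 1, ∃ X₁ : ℂ,
      RelGauge (fun U U' : ℂ => U = U') (fun U d t => U + t * d) (fun d : ℂ => ‖d‖) X₀ X₁ ((fun _ : ℕ => (1 : ℝ)) k) :=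
  fun _ _ _ _ _ _ _ => ⟨0, mem_closedBall_self zero_le_one, 0 + 1 * 1, 1, by simp, by simp, rfl⟩

/-- [folklore] The composed function's increment over a scale-`k` pair of unit defect: `‖G(V X₁) − G(V X₀)‖ ≤ gC K b · θ^(k−k′)`
for the birth generation (`k′ = b`), `0` otherwise. -/
theorem composed_increment_le (K : ℕ) (b : (BC K).Birth) (k' k : ℕ) {X₀ X₁ : ℂ}
    (h : RelGauge (fun U U' : ℂ => U = U') (fun U d t => U + t * d) (fun d : ℂ => ‖d‖) X₀ X₁ 1) :
    ‖FnC K b k' k' (vmap k' k X₁) - FnC K b k' k' (vmap k' k X₀)‖ ≤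
      if k' = b.val then gC K b.val * (1 / 4 : ℝ) ^ (k - k') else 0 := by
  obtain ⟨d, _, hd1, hX₁⟩ := h
  have hX : X₁ = X₀ + 1 * d := hX₁
  unfold FnC
  by_cases hk' : k' = b.val
  · rw [if_pos hk', if_pos hk', if_pos hk', ← mul_sub, hX, vmap_affine, add_sub_cancel_left, one_mul, norm_mul,
      Complex.norm_real, Real.norm_of_nonneg (gC_pos K b.val).le, norm_vmap]
    refine mul_le_mul_of_nonneg_left ?_ (gC_pos K b.val).le
    calc (1 / 4 : ℝ) ^ (k - k') * ‖d‖ ≤ (1 / 4 : ℝ) ^ (k - k') * 1 := mul_le_mul_of_nonneg_left hd1 (by positivity)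
      _ = (1 / 4 : ℝ) ^ (k - k') := mul_one _
  · rw [if_neg hk', if_neg hk', if_neg hk', sub_zero, norm_zero]

/-- [folklore] … and the UNIT pair `(0, 1)` ATTAINS it: `‖G(V 1) − G(V 0)‖ = gC K b · θ^(k−k′)` for the birth generation. -/
theorem composed_increment_unit (K : ℕ) (b : (BC K).Birth) (k : ℕ) :
    ‖FnC K b b.val b.val (vmap b.val k (0 + 1 * 1)) - FnC K b b.val b.val (vmap b.val k 0)‖ = sizeC K b.val k := by
  unfold FnC sizeC
  rw [if_pos rfl, if_pos rfl, zero_add, one_mul, ← mul_sub]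
  unfold vmap
  rw [mul_zero, mul_one, sub_zero, norm_mul, Complex.norm_real, Complex.norm_real, Real.norm_of_nonneg (gC_pos K b.val).le,
    Real.norm_of_nonneg (by positivity)]

/-- **`hsupX` — THE BOOKING CONVENTION ON UNIT PAIRS, ATTAINED** [decided toy]: W18's booked size `lin b k′ k` (= `sizeC K b k` for the
birth generation, `0` else) is `≤ sSup` of the COMPOSED function's increments over the scale-`k` unit pairs — the set is bounded by
`composed_increment_le` and the unit pair `(0, 1)` realises `sizeC` (`composed_increment_unit`), so `le_csSup`. [folklore] -/
theorem hsupX_C (K : ℕ) : ∀ (b : (BC K).Birth) (k' k : ℕ), (BC K).birthScale b ≤ k' → k' ≤ k → k ≤ (BC K).K →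
    RanBelow (budgetGate (TC K) (fun _ _ => (0 : ℝ)) (1 / 2) (SC K) (4 * 1 / 1) (fun _ : ℕ => ((2 : ℝ) ^ 2)⁻¹ * 1)) k →
    (TC K).lin b k' k ≤ sSup {x : ℝ | ∃ X₀ ∈ closedBall (0 : ℂ) 1, ∃ X₁ : ℂ,
      RelGauge (fun U U' : ℂ => U = U') (fun U d t => U + t * d) (fun d : ℂ => ‖d‖) X₀ X₁ ((fun _ : ℕ => (1 : ℝ)) k) ∧
        x = ‖FnC K b k' k' (vmap k' k X₁) - FnC K b k' k' (vmap k' k X₀)‖} := by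
  intro b k' k _ _ _ _
  have hbdd : BddAbove {x : ℝ | ∃ X₀ ∈ closedBall (0 : ℂ) 1, ∃ X₁ : ℂ,
      RelGauge (fun U U' : ℂ => U = U') (fun U d t => U + t * d) (fun d : ℂ => ‖d‖) X₀ X₁ ((fun _ : ℕ => (1 : ℝ)) k) ∧
        x = ‖FnC K b k' k' (vmap k' k X₁) - FnC K b k' k' (vmap k' k X₀)‖} := by
    refine ⟨if k' = b.val then gC K b.val * (1 / 4 : ℝ) ^ (k - k') else 0, ?_⟩
    rintro x ⟨X₀, -, X₁, hrel, rfl⟩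
    exact composed_increment_le K b k' k hrel
  show (if k' = b.val then sizeC K b.val k else 0) ≤ _
  by_cases hk' : k' = b.val
  · rw [if_pos hk']
    refine le_csSup hbdd ⟨0, mem_closedBall_self zero_le_one, 0 + 1 * 1, ⟨1, by simp, by simp, rfl⟩, ?_⟩
    rw [hk', composed_increment_unit]
  · rw [if_neg hk']
    refine Real.sSup_nonneg ?_
    rintro x ⟨_, -, _, -, rfl⟩
    exact norm_nonneg _

/-- **F-1 AT BIRTH ONLY** [decided toy]: W18's `hsl_C` read at the birth scale `k = k′` (`1^0·gen = gen`) — the socket asks nothing at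
later scales. [folklore] -/
theorem hG_C (K : ℕ) : ∀ (b : (BC K).Birth) (k' : ℕ), (BC K).birthScale b ≤ k' → k' ≤ (BC K).K →
    RanBelow (budgetGate (TC K) (fun _ _ => (0 : ℝ)) (1 / 2) (SC K) (4 * 1 / 1) (fun _ : ℕ => ((2 : ℝ) ^ 2)⁻¹ * 1)) k' →
    BirthSlice (FnC K b k' k') (fun U d t => U + t * d) (fun d : ℂ => ‖d‖) (closedBall (0 : ℂ) 1) 1 1 ((TC K).gen b k') := by
  intro b k' hb hk' hran
  simpa only [one_pow, one_mul] using hsl_C K b k' k' hb le_rfl hk' hran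

/-! ## §3 THE END: the socket fires — ROOT-C of record on W18's datum THROUGH the value map -/

/-- **THE VALUE MAP ACTS — S3u's SOCKET FIRES ON `towerC` AT `L = 2`** [decided toy]: (i) the push CONTRACTS every configuration by
EXACTLY `θ^(k−k′)`, `θ = ¼` (so it is NOT the identity for `k > k′`) AND (ii) `DressedStabilityStrict towerC ((2:ℝ)^4)` — N0e's
`dressedStabilityStrict_of_composition` BY NAME, ONE application, whose four deterministic families are S3u's socket lemmas
`hsl_of_birthSlice hG_C` (F-1 AT BIRTH only), `hdefw_of_push` ∕ `hrate_of_push` (pushed unit defect `θ^(k−k′)·1 ≤ 1·(2²)⁻¹^(k−k′)`,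
`θ = ψ`), **`hlin_of_push hVK_C hVrel_C hneX_C hsupX_C`** (the booking convention on UNIT pairs, PUSHED by the map), and W18's
`hbirth_C` ∕ `hreg_C` ∕ `hS_C` ∕ `hcount_C` BY NAME; constants W18's (`L = 2, a = 1, c_δ = r = w = 1, c̄ = 0, N₀ = A₀ = 1, m = ½, s̄⁰ = 0,
ρ′ = ½`; Λ = `2⁴` = the datum's count rate, k4).  Conjoined because the bare ROOT-C is W18's `dressedStabilityStrict_towerC`
(`dedup.landed`); the bare statements follow as `example`s.  Nothing of Bałaban's. [folklore] -/
theorem valueMap_fires :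
    (∀ (k' k : ℕ) (X : ℂ), ‖vmap k' k X‖ = (1 / 4 : ℝ) ^ (k - k') * ‖X‖) ∧ DressedStabilityStrict towerC ((2 : ℝ) ^ 4) :=
  ⟨norm_vmap, dressedStabilityStrict_of_composition towerC (L := 2) (a := 1) (cδ := 1) (cbar := 0) (N₀ := 1) (A₀ := 1)
    (m := 1 / 2) (sbar := 0) (ρ' := 1 / 2) (move := fun U d t : ℂ => U + t * d) (N := fun d : ℂ => ‖d‖) (w := 1) (r := 1)
    (by norm_num) zero_le_one zero_le_one one_pos le_rfl zero_le_one zero_le_one (by norm_num)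
    (by unfold locOf; norm_num) (by norm_num) (by norm_num)
    (fun _ _ _ => 0) (fun _ _ _ _ => 0) (fun _ K => SC K)
    (fun _ _ _ => le_rfl) (fun _ _ _ _ => le_rfl) (fun _ K => hS_C K) (fun _ K => hcount_C K) (fun _ _ _ _ => le_rfl)
    (fun _ K => hbirth_C K) (fun _ K => hreg_C K)
    (fun _ K b k' _ => FnC K b k' k') (fun _ _ _ _ U U' => U = U') (fun _ _ _ _ => closedBall (0 : ℂ) 1)
    (fun _ _ _ k' k => (1 / 4 : ℝ) ^ (k - k') * (fun _ : ℕ => (1 : ℝ)) k)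
    (fun _ K b k' _ => hinv_C K b k' k') (fun _ K => hsl_of_birthSlice (T := TC K) (hG_C K)) (fun U d => by simp)
    (fun _ K => hdefw_of_push (B := BC K) (θ := 1 / 4) (δX := fun _ : ℕ => (1 : ℝ)) (by norm_num) (by norm_num)
      (fun _ => zero_le_one) (fun _ => le_rfl))
    (fun _ K => hrate_of_push (B := BC K) (θ := 1 / 4) (ψ := ((2 : ℝ) ^ 2)⁻¹) (cδ := 1) (δX := fun _ : ℕ => (1 : ℝ))
      (by norm_num) (by norm_num) (fun _ => zero_le_one) (fun _ => le_rfl))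
    (fun _ K => hlin_of_push (T := TC K) (hVK_C K) (hVrel_C K) (hneX_C K) (hsupX_C K))⟩

/-- [folklore] The bare ROOT-C OF RECORD on the datum, reached THROUGH the value map (closed statement = W18's `dressedStabilityStrict_towerC`). -/
example : DressedStabilityStrict towerC ((2 : ℝ) ^ 4) := valueMap_fires.2

/-- [folklore] The headline through the value map (N0e `dressedStability_of_strict_comp` BY NAME). -/
example : DressedStability towerC := dressedStability_of_strict_comp valueMap_fires.2

/-- [folklore] ROOT-B through the value map (N0e `dressedBudget_of_strict_comp` + W18's `positionalCount_C` BY NAME). -/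
example {wt : Unit → ℕ → ℕ → ℝ} {wbar : ℝ} (hwbar : 0 ≤ wbar) (hw0 : ∀ p K, ∀ j ≤ K, 0 ≤ wt p K j)
    (hwb : ∀ p K, ∀ j ≤ K, wt p K j ≤ wbar) : DressedBudget towerC wt :=
  dressedBudget_of_strict_comp (L := 2) (N₀ := 1) valueMap_fires.2 zero_le_one hwbar hw0 hwb fun _ K => positionalCount_C K

/-- [folklore] The push is NOT the identity at any later scale: `V k′ (k′+1) 1 = ¼ ≠ 1`. -/
theorem vmap_ne_id (k' : ℕ) : vmap k' (k' + 1) 1 ≠ 1 := by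
  unfold vmap
  rw [mul_one, show k' + 1 - k' = 1 by omega, pow_one]
  norm_num

end Summit.QuantumFields.BalabanUV.T4Continuum.NE1p.DressedValueMapWitness

end
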